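import Summits.Ventures.HSemireg.Transfer
import Summits.Ventures.HSemireg.SheafSeed
import Summits.Ventures.HSemireg.SheafSeedOnAnchor
import Summits.Ventures.HSemireg.UnionSeed
import Summits.Ventures.HSemireg.SubschemeSeed
import Summits.Ventures.HSemireg.Leverage
import Summits.Ventures.HSemireg.TenfoldDoor
import Summits.Ventures.HSemireg.Certificate
import Summits.HodgeConjecture.HodgeConjecture.Theorems.Ring2AbelianAllWeilCellsBlochSeed
import HarnessLib

/-!
# Venture HSemireg — COMPONENT CELLS: «HC on that component» at `g = 2n` (target `g = 6`) as ONE declaration per door,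
# indexed by the referee's component key `(K = ℚ(√-d), δ ∈ ℚˣ/Nm Kˣ)`

HONEST FRAMING (page 1 of every file of the cell `pub-hsemireg`). Lean INDEX of a computation cell; nothing about any explicit
variety is asserted or constructed; every published theorem enters as a hypothesis BY NAME (a `def … : Prop` of `Literature/`);
no number computed by the cell appears here. Nothing in this file says that the Hodge conjecture, `HC_CM` or `HC_AV` is proved.
Target seat t-7 (the g = 6 TARGET team's Lean seat): when a seat of the cell certifies a semiregular representative of a Weil
class at a CM point of a Weil-type component of `𝒜₆`, the verdict «by the cited transfer theorem the Weil classes are algebraic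
on every member of THAT component» (referee protocol §3-SIX, X1/X7) must be ONE kernel-checked declaration whose hypotheses are
exactly the cited facts plus the certified object. This file supplies those declarations; it introduces NO definition and NO
named fact.

## The component, in the tree's vocabulary

The Hodge summit's Ring-2 cell vocabulary (`Ring2HypothesesWeilComponents.lean`, van Geemen LNM 1594, 4.14 and Lemma 5.2):
the Weil-type components of `𝒜_{2n}` for `K = ℚ(√-d)` are indexed by the discriminant class
`δ = [det H] ∈ weilNormResidueGroup d = ℚˣ ⧸ Nm(K_dˣ)` of the `K`-Hermitian form of a `K`-symmetrised polarization
`h_K = d·e^*a + φ^*e^*a` (`HasWeilDiscriminantNondeg A φ n d h_K δ`: a rational Gram witness `det (a + b√-d) = q`, `δ = [q]`),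
and **`WeilClassesComponent n d δ`** says: every rational `(n,n)` class of the Weil plane of EVERY polarized member
`(A, φ, h_K)` of the cell `(n, d, δ)` is algebraic. At `n = 3` this is «HC (for the Weil classes) on that component of
`𝒜₆`»; the split component is `δ = splitDiscriminantClass 3 d = [-1]` (Markman 2025 Thm. 1.5.1, preprint: a RE-DERIVATION
there), every other realisable cell (`sign δ = -1`) is OPEN in print; cells with `sign δ = +1` are empty and hold vacuously
(`Ring2.AbelianAll.weilClassesComponent_three_of_weilSign_eq_one`, tree — so a TARGET-TABLE lists only the realisable
cells `sign δ = -1`).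

## What is PROVED here (0 sorry; bookkeeping over landed arrows, no new mathematics)

§1 ONE NAME PER DOOR, member form, any `(n, d, δ)`: a polarized member `(P, ψ₀, h_K)` of Weil type `(n, d)` lying in the
   cell (`HasWeilDiscriminantNondeg … δ`), a non-zero rational Weil class `w` on it, and ONE certified object for `q·h_Kⁿ + w`
   ⟹ `WeilClassesComponent n d δ`, granting BY NAME Deligne's reach-by-similitude `weilFamilyReach_similar` and the door's
   transport fact:
   * `weilClassesComponent_of_blochSeedAt_member` — D1, integral lci (`HasBlochSeedAt`; `BlochSemiregularSpread (2n) n`,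
     Bloch (7.4)/(7.5) = Buchweitz–Flenner Thm. 5.2, REFEREED);
   * `weilClassesComponent_of_unionSeedAt_member` — D1′, reduced lci with smooth components (`HasBlochUnionSeedAt`;
     `BlochSemiregularSpreadSmoothComponents (2n) n`, REFEREED);
   * `weilClassesComponent_of_subschemeSeedAt_member` — D1″, arbitrary lci (`HasBlochSubschemeSeedAt`;
     `BlochSemiregularSpreadOfSubscheme (2n) n`, REFEREED);
   * `weilClassesComponent_of_sheafSeedAt_member` — D2, finite locally free `I`-semiregular `ℰ₀` (`HasBFSheafSeedAt`;
     `BuchweitzFlenner2003_variationalHodge_ISemiregular` = BF Thm. 5.1, REFEREED).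
   Mechanism (all in the tree): door bridge ⟹ `WeilAnchorLocalClause` at the anchor (this venture / `WeilClassesBlochSeed.lean`);
   `Ring2.AbelianAll.hasLocallyAlgebraicWeilAnchorInClass_of_member`; Landherr/van Geemen 5.2 (3)–(4): same class ⟹ Weil-similar;
   `Ring2.AbelianAll.weilClassesComponent_of_reachSimilar_of_anchorInClass` (Deligne's family through the anchor reaches every
   member of the cell; Charles–Schnell countable union DISCHARGED in the tree; Baire; Lefschetz `(1,1)`; one Weil class suffices).
§2 LADDER INPUT: `weilClassesComponent_of_weilAlgebraicAll` — the per-`d` conclusion `WeilAlgebraicAll n d` of the venture's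
   leverage / tenfold doors (`Leverage.lean`, `TenfoldDoor.lean`) settles EVERY cell `(n, d, δ)`; `weilSixfoldCells_of_eightfold_seed`
   — one hyperbolic Bloch seed on a split `√-d`-Weil EIGHTFOLD ⟹ every sixfold cell of that `d`. (The cell's DOOR #2 — `ℚ(i)`, split
   TENFOLD, p3's `TenfoldDoor.lean` — reads cell by cell through the same bridge; its cell form is appended when that module is built.)
§3 THE `g = 6` TEMPLATES (`n = 3`, facts at `(6, 3)`): `weilSixfoldComponent_of_blochSeedAt_member`,
   `weilSixfoldComponent_of_unionSeedAt_member`, `weilSixfoldComponent_of_subschemeSeedAt_member`,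
   `weilSixfoldComponent_of_sheafSeedAt_member` — the declarations a TARGET-TABLE row instantiates (row contract:
   `target-g6/T7-LEAN-INSTANTIATION.md` §3: `d`; Weil type `(3, d)`; frame + rational Gram `a, b` with `det = q`, `δ = [q]`;
   `w`; the object by door; the certificate `M₀·R₀ = 1` of `Certificate.lean` for the `IsBlochSemiregular` conjunct).
§4 THE PRIMITIVE ROW FORM (door D1): `weilSixfoldComponent_of_lci_certificate` — binder by binder: Weil type, `h_K`, Gram
   placement, `w`, the lci `Z` (closed immersion, regular of codimension 3, integral, codimension ≥ 3 pointwise, support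
   identity) and the engine's certificate (`BlochPairingCoordinates` modelling claim + exact `M₀` over a number ring with right
   inverse `R₀`), composed through `BlochPairingCoordinates.isBlochSemiregular_of_certificate_map`.

NOT hypotheses anywhere below: `HC_CM`, CM density / André–Oort, finiteness of Mumford–Tate types, «HC at the CM point» (the class
identity `q·h_Kⁿ + w = μ·[object]` is part of the seed). The Siegel-modular rendering of the same verdict (a connected component of
the Hodge locus of the universal family over `𝒜_{g,δ',N}`) is th-3/p3's `hc_on_siegelComponent_of_semiregular_of_smul_add` and its
door variants with `g := 6`; it is cited, not restated.

References: [Bloch1972Semiregularity] S. Bloch, Invent. Math. 17 (1972), Thm. (7.4), Remark (7.5); [BuchweitzFlenner2003]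
Compositio Math. 137 (2003), Thm. 5.1, 5.2; [Deligne1982HodgeCycles] LNM 900, proof of Thm. 4.8; [vanGeemen1994HodgeAV] LNM 1594,
4.14, Lemma 5.2, Thm. 5.3, 5.4–5.5; [Schoen1998HodgeWeilAddendum] Compositio Math. 114 (1998) §10; [Markman2025SecantWeil]
arXiv:2502.03415 (preprint), §1.1, Thm. 1.5.1; [CharlesSchnell2014Notes] Prop. 11.3.11.
-/

noncomputable section

open CategoryTheory AlgebraicGeometry

namespace Summit.Ventures.HSemireg

open Literature.AlgebraicGeometry Literature.AlgebraicGeometry.Motives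
open Literature.AlgebraicGeometry.HodgeTheory
open Literature.AlgebraicGeometry.VanGeemen1994
open Literature.AlgebraicTopology.SingularHomology
open Summit.HodgeConjecture.HodgeConjecture.Ring2.Hypotheses
open Summit.HodgeConjecture.HodgeConjecture.Ring2.AbelianAll
open Summit.HodgeConjecture.HodgeConjecture.Cruxes.HodgeAbelianVarieties.EStepSecantInduction (WeilAlgebraicAll)

/-! ## §1 One name per door: a certified object on a member of the cell `(n, d, δ)` ⟹ `WeilClassesComponent n d δ` -/

/-- **Door D1 (integral lci), cell form.** Granting BY NAME Deligne's reach-by-similitude `weilFamilyReach_similar` and Bloch's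
theorem `BlochSemiregularSpread (2n) n` (both REFEREED named facts): a polarized member `(P, ψ₀, h_K = d·e^*a + ψ₀^*e^*a)` of
Weil type `(n, d)` of the cell `δ` (`HasWeilDiscriminantNondeg … δ`), a non-zero rational Weil class `w` on it, and an integral
Bloch-semiregular lci of codimension `n` carrying `q·h_Kⁿ + w` (`HasBlochSeedAt n P h_K w`) make every rational `(n,n)` Weil
class of EVERY member of the cell algebraic: `WeilClassesComponent n d δ`. (Composition of
`weilAnchorLocalClause_of_blochSpread_of_blochSeedAt`, `hasLocallyAlgebraicWeilAnchorInClass_of_member`,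
`weilClassesComponent_of_reachSimilar_of_anchorInClass`; nothing asserted.) [cite: Bloch1972Semiregularity, Thm. (7.4) and Remark (7.5)]
[cite: Deligne1982HodgeCycles, proof of Thm. 4.8] [cite: vanGeemen1994HodgeAV, Lemma 5.2 (3)–(4) and Thm. 5.3] -/
theorem weilClassesComponent_of_blochSeedAt_member {n d : ℕ} {δ : weilNormResidueGroup d}
    (hF : weilFamilyReach_similar) (hB : BlochSemiregularSpread (2 * n) n)
    {P : AbelianVariety ℂ} {ψ₀ : P ⟶ P} (hW : IsWeilType P ψ₀ n d) (e : ProjectiveEmbedding P.X)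
    {a : complexBetti (projectiveSpace e.n ℂ) 2} (haQ : IsRationalClass a) (ha0 : a ≠ 0)
    (hδ : HasWeilDiscriminantNondeg P ψ₀ n d (symmetrisedClass d P ψ₀ e a) δ)
    {w : complexBetti P.X (2 * n)} (hwW : w ∈ weilClassesOf P ψ₀ n d) (hwQ : IsRationalClass w) (hw0 : w ≠ 0)
    (hS : HasBlochSeedAt n P (symmetrisedClass d P ψ₀ e a) w) :
    WeilClassesComponent n d δ :=
  weilClassesComponent_of_reachSimilar_of_anchorInClass hF hW.pos hW.d_pos
    (hasLocallyAlgebraicWeilAnchorInClass_of_member hW e haQ ha0 hδ hwW hwQ hw0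
      (weilAnchorLocalClause_of_blochSpread_of_blochSeedAt d hB hS))

/-- **Door D1′ (reduced lci with smooth components, e.g. Schoen's `Δ ∪ (C × C)`), cell form.** As
`weilClassesComponent_of_blochSeedAt_member`, with the transport fact `BlochSemiregularSpreadSmoothComponents (2n) n` (Bloch
(7.4)/(7.5) for reduced lci with smooth components, REFEREED) and the object `HasBlochUnionSeedAt n P h_K w`
(`q·h_Kⁿ + w = μ·Σ_j ι_{j*}1`, `μ ≠ 0`). [cite: Bloch1972Semiregularity, Thm. (7.4) and Remark (7.5)]
[cite: Deligne1982HodgeCycles, proof of Thm. 4.8] [cite: vanGeemen1994HodgeAV, Lemma 5.2 (3)–(4) and Thm. 5.3] -/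
theorem weilClassesComponent_of_unionSeedAt_member {n d : ℕ} {δ : weilNormResidueGroup d}
    (hF : weilFamilyReach_similar) (hB : BlochSemiregularSpreadSmoothComponents (2 * n) n)
    {P : AbelianVariety ℂ} {ψ₀ : P ⟶ P} (hW : IsWeilType P ψ₀ n d) (e : ProjectiveEmbedding P.X)
    {a : complexBetti (projectiveSpace e.n ℂ) 2} (haQ : IsRationalClass a) (ha0 : a ≠ 0)
    (hδ : HasWeilDiscriminantNondeg P ψ₀ n d (symmetrisedClass d P ψ₀ e a) δ)
    {w : complexBetti P.X (2 * n)} (hwW : w ∈ weilClassesOf P ψ₀ n d) (hwQ : IsRationalClass w) (hw0 : w ≠ 0)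
    (hS : HasBlochUnionSeedAt n P (symmetrisedClass d P ψ₀ e a) w) :
    WeilClassesComponent n d δ :=
  weilClassesComponent_of_reachSimilar_of_anchorInClass hF hW.pos hW.d_pos
    (hasLocallyAlgebraicWeilAnchorInClass_of_member hW e haQ ha0 hδ hwW hwQ hw0
      (weilAnchorLocalClause_of_blochSpreadSmoothComponents_of_unionSeedAt d hB hS))

/-- **Door D1″ (arbitrary lci: singular components / non-reduced structure allowed), cell form.** As
`weilClassesComponent_of_blochSeedAt_member`, with the transport fact `BlochSemiregularSpreadOfSubscheme (2n) n` (Bloch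
(7.1)/(7.4) for arbitrary lci, class `subschemeClass`, REFEREED) and the object `HasBlochSubschemeSeedAt n P h_K w`
(`q·h_Kⁿ + w = μ·subschemeClass`, `μ ≠ 0`). [cite: Bloch1972Semiregularity, Thm. (7.1), (7.4) and Remark (7.5)]
[cite: Deligne1982HodgeCycles, proof of Thm. 4.8] [cite: vanGeemen1994HodgeAV, Lemma 5.2 (3)–(4) and Thm. 5.3] -/
theorem weilClassesComponent_of_subschemeSeedAt_member {n d : ℕ} {δ : weilNormResidueGroup d}
    (hF : weilFamilyReach_similar) (hB : BlochSemiregularSpreadOfSubscheme (2 * n) n)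
    {P : AbelianVariety ℂ} {ψ₀ : P ⟶ P} (hW : IsWeilType P ψ₀ n d) (e : ProjectiveEmbedding P.X)
    {a : complexBetti (projectiveSpace e.n ℂ) 2} (haQ : IsRationalClass a) (ha0 : a ≠ 0)
    (hδ : HasWeilDiscriminantNondeg P ψ₀ n d (symmetrisedClass d P ψ₀ e a) δ)
    {w : complexBetti P.X (2 * n)} (hwW : w ∈ weilClassesOf P ψ₀ n d) (hwQ : IsRationalClass w) (hw0 : w ≠ 0)
    (hS : HasBlochSubschemeSeedAt n P (symmetrisedClass d P ψ₀ e a) w) :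
    WeilClassesComponent n d δ :=
  weilClassesComponent_of_reachSimilar_of_anchorInClass hF hW.pos hW.d_pos
    (hasLocallyAlgebraicWeilAnchorInClass_of_member hW e haQ ha0 hδ hwW hwQ hw0
      (weilAnchorLocalClause_of_blochSpreadOfSubscheme_of_subschemeSeedAt d hB hS))

/-- **Door D2 (finite locally free `I`-semiregular vector bundle), cell form.** As
`weilClassesComponent_of_blochSeedAt_member`, with the transport fact `BuchweitzFlenner2003_variationalHodge_ISemiregular`
(Buchweitz–Flenner Thm. 5.1, general finite `I`, REFEREED) and the object `HasBFSheafSeedAt C n I P h_K w` (on every model of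
`P` an `I`-semiregular `ℰ₀` with `ch_n(ℰ₀) = q·h_Kⁿ + w`, `ch_p(ℰ₀) = c_p·h_Kᵖ` for `p ∈ I ∖ {n}`, `n ∈ I`; `C` a Chern character
theory on Betti carriers). [cite: BuchweitzFlenner2003, Thm. 5.1] [cite: Deligne1982HodgeCycles, proof of Thm. 4.8]
[cite: vanGeemen1994HodgeAV, Lemma 5.2 (3)–(4) and Thm. 5.3] -/
theorem weilClassesComponent_of_sheafSeedAt_member {n d : ℕ} {δ : weilNormResidueGroup d}
    (hF : weilFamilyReach_similar) (C : ChernCharacterBetti) {I : Finset ℕ}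
    (hBF : BuchweitzFlenner2003_variationalHodge_ISemiregular)
    {P : AbelianVariety ℂ} {ψ₀ : P ⟶ P} (hW : IsWeilType P ψ₀ n d) (e : ProjectiveEmbedding P.X)
    {a : complexBetti (projectiveSpace e.n ℂ) 2} (haQ : IsRationalClass a) (ha0 : a ≠ 0)
    (hδ : HasWeilDiscriminantNondeg P ψ₀ n d (symmetrisedClass d P ψ₀ e a) δ)
    {w : complexBetti P.X (2 * n)} (hwW : w ∈ weilClassesOf P ψ₀ n d) (hwQ : IsRationalClass w) (hw0 : w ≠ 0)
    (hS : HasBFSheafSeedAt C n I P (symmetrisedClass d P ψ₀ e a) w) :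
    WeilClassesComponent n d δ :=
  weilClassesComponent_of_reachSimilar_of_anchorInClass hF hW.pos hW.d_pos
    (hasLocallyAlgebraicWeilAnchorInClass_of_member hW e haQ ha0 hδ hwW hwQ hw0
      (weilAnchorLocalClause_of_BF_of_sheafSeedAt d C hBF hS))

/-! ## §2 The ladder input: `WeilAlgebraicAll n d` settles every cell of that `(n, d)` -/

/-- **A per-`d` conclusion settles every cell.** `WeilAlgebraicAll n d` (every rational `(n,n)` Weil class of every
`√-d`-Weil `2n`-fold is algebraic — the conclusion of `Leverage.lean` / `TenfoldDoor.lean` from an object one or two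
dimensions UP) implies `WeilClassesComponent n d δ` for every `δ` (the cell predicate only adds binders). [folklore]
[cite: vanGeemen1994HodgeAV, 4.14 and Lemma 5.2] -/
theorem weilClassesComponent_of_weilAlgebraicAll {n d : ℕ} (h : WeilAlgebraicAll n d) (δ : weilNormResidueGroup d) :
    WeilClassesComponent n d δ :=
  fun A φ hA _ hφ _e _a _ _ _ c hcQ hcH hcW => h A φ hA hφ c hcW hcQ hcH

/-- **Per `d`: ONE hyperbolic Bloch seed on a split `√-d`-Weil EIGHTFOLD settles EVERY sixfold cell `(3, d, δ)`** — split and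
non-split alike (`Leverage.weilSixfolds_slice_of_eightfold_seed` read cell by cell; transport `BlochSemiregularSpread 8 4` and
reach `weilFamilyReach_hyperbolic`, REFEREED named facts; the degeneration edge `stub_descend` is PROVED in the tree).
[cite: Bloch1972Semiregularity, Thm. (7.4) and Remark (7.5)] [cite: Schoen1998HodgeWeilAddendum, §10]
[cite: Deligne1982HodgeCycles, proof of Thm. 4.8] -/
theorem weilSixfoldCells_of_eightfold_seed (d : ℕ) (hd : 0 < d) (hB : BlochSemiregularSpread 8 4)
    (hF : weilFamilyReach_hyperbolic) (hS : HasHyperbolicBlochSeed 4 d) (δ : weilNormResidueGroup d) :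
    WeilClassesComponent 3 d δ :=
  weilClassesComponent_of_weilAlgebraicAll (weilSixfolds_slice_of_eightfold_seed d hd hB hF hS) δ

/-! ## §3 The `g = 6` templates (`n = 3`; transport facts at `(6, 3)`) — what a TARGET-TABLE row instantiates -/

/-- **`g = 6`, door D1 (integral lci threefold on a Weil-type CM sixfold), cell `(3, d, δ)`.** Granting BY NAME
`weilFamilyReach_similar` and `BlochSemiregularSpread 6 3` (REFEREED): a polarized abelian sixfold `(P, ψ₀, h_K)` of Weil type
`(3, d)` in the cell `δ`, a non-zero rational Weil class `w`, and an integral Bloch-semiregular lci threefold carrying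
`q·h_K³ + w` ⟹ `WeilClassesComponent 3 d δ`: the rational `(3,3)` Weil classes of EVERY member of that component of `𝒜₆` are
algebraic. For `δ = splitDiscriminantClass 3 d` a re-derivation of Markman's split-sixfold theorem by Bloch's route; for
`δ ≠ [-1]` with `sign δ = -1` a case not in print. Nothing asserted. [cite: Bloch1972Semiregularity, Thm. (7.4) and Remark (7.5)]
[cite: Deligne1982HodgeCycles, proof of Thm. 4.8] [cite: Markman2025SecantWeil, Thm. 1.5.1 (preprint, unrefereed)] -/
theorem weilSixfoldComponent_of_blochSeedAt_member {d : ℕ} {δ : weilNormResidueGroup d}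
    (hF : weilFamilyReach_similar) (hB : BlochSemiregularSpread 6 3)
    {P : AbelianVariety ℂ} {ψ₀ : P ⟶ P} (hW : IsWeilType P ψ₀ 3 d) (e : ProjectiveEmbedding P.X)
    {a : complexBetti (projectiveSpace e.n ℂ) 2} (haQ : IsRationalClass a) (ha0 : a ≠ 0)
    (hδ : HasWeilDiscriminantNondeg P ψ₀ 3 d (symmetrisedClass d P ψ₀ e a) δ)
    {w : complexBetti P.X 6} (hwW : w ∈ weilClassesOf P ψ₀ 3 d) (hwQ : IsRationalClass w) (hw0 : w ≠ 0)
    (hS : HasBlochSeedAt 3 P (symmetrisedClass d P ψ₀ e a) w) :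
    WeilClassesComponent 3 d δ :=
  weilClassesComponent_of_blochSeedAt_member hF hB hW e haQ ha0 hδ hwW hwQ hw0 hS

/-- **`g = 6`, door D1′ (reduced lci threefold with smooth components), cell `(3, d, δ)`** — transport
`BlochSemiregularSpreadSmoothComponents 6 3` (REFEREED), object `HasBlochUnionSeedAt 3 P h_K w`.
[cite: Bloch1972Semiregularity, Thm. (7.4) and Remark (7.5)] [cite: Deligne1982HodgeCycles, proof of Thm. 4.8] -/
theorem weilSixfoldComponent_of_unionSeedAt_member {d : ℕ} {δ : weilNormResidueGroup d}
    (hF : weilFamilyReach_similar) (hB : BlochSemiregularSpreadSmoothComponents 6 3)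
    {P : AbelianVariety ℂ} {ψ₀ : P ⟶ P} (hW : IsWeilType P ψ₀ 3 d) (e : ProjectiveEmbedding P.X)
    {a : complexBetti (projectiveSpace e.n ℂ) 2} (haQ : IsRationalClass a) (ha0 : a ≠ 0)
    (hδ : HasWeilDiscriminantNondeg P ψ₀ 3 d (symmetrisedClass d P ψ₀ e a) δ)
    {w : complexBetti P.X 6} (hwW : w ∈ weilClassesOf P ψ₀ 3 d) (hwQ : IsRationalClass w) (hw0 : w ≠ 0)
    (hS : HasBlochUnionSeedAt 3 P (symmetrisedClass d P ψ₀ e a) w) :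
    WeilClassesComponent 3 d δ :=
  weilClassesComponent_of_unionSeedAt_member hF hB hW e haQ ha0 hδ hwW hwQ hw0 hS

/-- **`g = 6`, door D1″ (arbitrary lci threefold), cell `(3, d, δ)`** — transport `BlochSemiregularSpreadOfSubscheme 6 3`
(REFEREED), object `HasBlochSubschemeSeedAt 3 P h_K w`. [cite: Bloch1972Semiregularity, Thm. (7.1), (7.4) and Remark (7.5)]
[cite: Deligne1982HodgeCycles, proof of Thm. 4.8] -/
theorem weilSixfoldComponent_of_subschemeSeedAt_member {d : ℕ} {δ : weilNormResidueGroup d}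
    (hF : weilFamilyReach_similar) (hB : BlochSemiregularSpreadOfSubscheme 6 3)
    {P : AbelianVariety ℂ} {ψ₀ : P ⟶ P} (hW : IsWeilType P ψ₀ 3 d) (e : ProjectiveEmbedding P.X)
    {a : complexBetti (projectiveSpace e.n ℂ) 2} (haQ : IsRationalClass a) (ha0 : a ≠ 0)
    (hδ : HasWeilDiscriminantNondeg P ψ₀ 3 d (symmetrisedClass d P ψ₀ e a) δ)
    {w : complexBetti P.X 6} (hwW : w ∈ weilClassesOf P ψ₀ 3 d) (hwQ : IsRationalClass w) (hw0 : w ≠ 0)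
    (hS : HasBlochSubschemeSeedAt 3 P (symmetrisedClass d P ψ₀ e a) w) :
    WeilClassesComponent 3 d δ :=
  weilClassesComponent_of_subschemeSeedAt_member hF hB hW e haQ ha0 hδ hwW hwQ hw0 hS

/-- **`g = 6`, door D2 (finite locally free `I`-semiregular vector bundle on the sixfold), cell `(3, d, δ)`** — transport
`BuchweitzFlenner2003_variationalHodge_ISemiregular` (BF Thm. 5.1, REFEREED), object `HasBFSheafSeedAt C 3 I P h_K w`.
[cite: BuchweitzFlenner2003, Thm. 5.1] [cite: Deligne1982HodgeCycles, proof of Thm. 4.8] -/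
theorem weilSixfoldComponent_of_sheafSeedAt_member {d : ℕ} {δ : weilNormResidueGroup d}
    (hF : weilFamilyReach_similar) (C : ChernCharacterBetti) {I : Finset ℕ}
    (hBF : BuchweitzFlenner2003_variationalHodge_ISemiregular)
    {P : AbelianVariety ℂ} {ψ₀ : P ⟶ P} (hW : IsWeilType P ψ₀ 3 d) (e : ProjectiveEmbedding P.X)
    {a : complexBetti (projectiveSpace e.n ℂ) 2} (haQ : IsRationalClass a) (ha0 : a ≠ 0)
    (hδ : HasWeilDiscriminantNondeg P ψ₀ 3 d (symmetrisedClass d P ψ₀ e a) δ)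
    {w : complexBetti P.X 6} (hwW : w ∈ weilClassesOf P ψ₀ 3 d) (hwQ : IsRationalClass w) (hw0 : w ≠ 0)
    (hS : HasBFSheafSeedAt C 3 I P (symmetrisedClass d P ψ₀ e a) w) :
    WeilClassesComponent 3 d δ :=
  weilClassesComponent_of_sheafSeedAt_member hF C hBF hW e haQ ha0 hδ hwW hwQ hw0 hS

/-! ## §4 The fully primitive `g = 6` row, door D1: lci data + the engine's certificate (Certificate.lean contract) -/

/-- **`g = 6`, door D1, PRIMITIVE ROW FORM** — the shape of one TARGET-TABLE row, binder by binder. Granting BY NAME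
`weilFamilyReach_similar` and `BlochSemiregularSpread 6 3` (REFEREED): (R1) a polarized abelian sixfold `(P, ψ₀)` of Weil
type `(3, d)`; (R2) the `K`-symmetrised hyperplane class `h_K = d·e^*a + ψ₀^*e^*a`; (R3) PLACEMENT: a non-degenerate rational
Gram witness of class `δ` (`HasWeilDiscriminantNondeg`); (R4) a non-zero rational Weil class `w`; (R5) the OBJECT: a closed
immersion `i : Z ↪ P`, regular of codimension `3`, `Z` integral of codimension `≥ 3` pointwise, with `q·h_K³ + w` supported
on `Z`; (R6) the CERTIFICATE: the engine's modelling claim `Co : BlochPairingCoordinates i 2 4 2 ℂ` (coordinates of the tree's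
Bloch pairing map `H²(P, Ω⁴_P) → H²(Z, 𝒩^∨ ⊗ ω_Z)`, the map Bloch dualises to define `π : H¹(Z, 𝒩) → H⁴(P, Ω²)`) whose matrix
is `M₀.map f` for an exact `M₀` over a number ring `K` (`f : K →+* ℂ`) with a RIGHT INVERSE `R₀`, `M₀·R₀ = 1` (so `π` is
injective: `IsBlochSemiregular i 6 3` by `BlochPairingCoordinates.isBlochSemiregular_of_certificate_map`) ⟹
`WeilClassesComponent 3 d δ`. Nothing asserted; the tree constructs no instance of (R1)–(R6).
[cite: Bloch1972Semiregularity, §1, Thm. (7.4) and Remark (7.5)] [cite: BuchweitzFlenner2003, (8.1) (2) and Thm. 5.2]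
[cite: Deligne1982HodgeCycles, proof of Thm. 4.8] [cite: vanGeemen1994HodgeAV, Lemma 5.2 (2)–(4) and Thm. 5.3] -/
theorem weilSixfoldComponent_of_lci_certificate {d : ℕ} {δ : weilNormResidueGroup d}
    (hF : weilFamilyReach_similar) (hB : BlochSemiregularSpread 6 3)
    {P : AbelianVariety ℂ} {ψ₀ : P ⟶ P} (hW : IsWeilType P ψ₀ 3 d) (e : ProjectiveEmbedding P.X)
    {a : complexBetti (projectiveSpace e.n ℂ) 2} (haQ : IsRationalClass a) (ha0 : a ≠ 0)
    (hδ : HasWeilDiscriminantNondeg P ψ₀ 3 d (symmetrisedClass d P ψ₀ e a) δ)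
    {w : complexBetti P.X 6} (hwW : w ∈ weilClassesOf P ψ₀ 3 d) (hwQ : IsRationalClass w) (hw0 : w ≠ 0)
    {Z : Scheme.{0}} (i : Z ⟶ P.X.left) (hci : IsClosedImmersion i) (hreg : IsRegularImmersionOfCodim i 3)
    (hint : AlgebraicGeometry.IsIntegral Z) (hcod : ∀ z ∈ Set.range i.base, (3 : ℕ∞) ≤ Order.coheight z)
    (q : ℚ) (hsupp : ((q : ℚ) : ℂ) • cupPowTwo (symmetrisedClass d P ψ₀ e a) 3 + w ∈
      classesSupportedOn P.X (Set.range i.base) 6)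
    (Co : BlochPairingCoordinates i 2 4 2 ℂ) {K : Type*} [CommRing K] (f : K →+* ℂ)
    (M₀ : Matrix (Fin Co.tgtDim) (Fin Co.srcDim) K) (hM : Co.matrix = M₀.map f)
    (R₀ : Matrix (Fin Co.srcDim) (Fin Co.tgtDim) K) (hR : M₀ * R₀ = 1) :
    WeilClassesComponent 3 d δ :=
  weilSixfoldComponent_of_blochSeedAt_member hF hB hW e haQ ha0 hδ hwW hwQ hw0
    ⟨Z, i, q, hci, hreg, hint, hcod,
      Co.isBlochSemiregular_of_certificate_map (m := 3) rfl rfl rfl rfl f M₀ hM R₀ hR, hsupp⟩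

open Summit.Ventures.HSemireg.GeneralStructure (HasHyperbolicBFSheafSeed)

/-! ## §5 (appended) Door-independent member form, and the cell's DOOR #2 (split `ℚ(i)`-tenfold) read cell by cell -/

/-- **Door-independent member form.** Granting BY NAME Deligne's reach-by-similitude `weilFamilyReach_similar` (REFEREED): a
polarized member `(P, ψ₀, h_K)` of Weil type `(n, d)` of the cell `δ`, a non-zero rational Weil class `w` on it, and the LOCAL
VARIATIONAL CLAUSE at that anchor (`WeilAnchorLocalClause n d P h_K w`: along every smooth projective `√-d`-Weil family through a
chart at `P`, `q·Hⁿ + W` stays algebraic near `P`) ⟹ `WeilClassesComponent n d δ`. Every door of this file factors through this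
declaration (the door's transport fact produces the clause); a door the tree does not type (e.g. an equivariant-semiregularity
transfer) enters here as the ONE explicitly non-cited hypothesis `hloc`, stated as such by the consumer.
[cite: Deligne1982HodgeCycles, proof of Thm. 4.8] [cite: vanGeemen1994HodgeAV, Lemma 5.2 (3)–(4) and Thm. 5.3] -/
theorem weilClassesComponent_of_localClause_member {n d : ℕ} {δ : weilNormResidueGroup d}
    (hF : weilFamilyReach_similar) {P : AbelianVariety ℂ} {ψ₀ : P ⟶ P} (hW : IsWeilType P ψ₀ n d)
    (e : ProjectiveEmbedding P.X) {a : complexBetti (projectiveSpace e.n ℂ) 2} (haQ : IsRationalClass a) (ha0 : a ≠ 0)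
    (hδ : HasWeilDiscriminantNondeg P ψ₀ n d (symmetrisedClass d P ψ₀ e a) δ)
    {w : complexBetti P.X (2 * n)} (hwW : w ∈ weilClassesOf P ψ₀ n d) (hwQ : IsRationalClass w) (hw0 : w ≠ 0)
    (hloc : WeilAnchorLocalClause n d P (symmetrisedClass d P ψ₀ e a) w) :
    WeilClassesComponent n d δ :=
  weilClassesComponent_of_reachSimilar_of_anchorInClass hF hW.pos hW.d_pos
    (hasLocallyAlgebraicWeilAnchorInClass_of_member hW e haQ ha0 hδ hwW hwQ hw0 hloc)

/-- **`g = 6` door-independent template** (`n = 3`): reach ∧ a Weil-type `(3, d)` member of the cell with its Gram placement ∧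
`w` ∧ the local clause at that member ⟹ `WeilClassesComponent 3 d δ`. [cite: Deligne1982HodgeCycles, proof of Thm. 4.8] -/
theorem weilSixfoldComponent_of_localClause_member {d : ℕ} {δ : weilNormResidueGroup d}
    (hF : weilFamilyReach_similar) {P : AbelianVariety ℂ} {ψ₀ : P ⟶ P} (hW : IsWeilType P ψ₀ 3 d)
    (e : ProjectiveEmbedding P.X) {a : complexBetti (projectiveSpace e.n ℂ) 2} (haQ : IsRationalClass a) (ha0 : a ≠ 0)
    (hδ : HasWeilDiscriminantNondeg P ψ₀ 3 d (symmetrisedClass d P ψ₀ e a) δ)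
    {w : complexBetti P.X 6} (hwW : w ∈ weilClassesOf P ψ₀ 3 d) (hwQ : IsRationalClass w) (hw0 : w ≠ 0)
    (hloc : WeilAnchorLocalClause 3 d P (symmetrisedClass d P ψ₀ e a) w) :
    WeilClassesComponent 3 d δ :=
  weilClassesComponent_of_localClause_member hF hW e haQ ha0 hδ hwW hwQ hw0 hloc

/-- **DOOR #2 of the cell (`K = ℚ(i)`, level `5`, split tenfold), CELL FORM — what a tenfold pass instantiates at `g = 6`.**
Granting BY NAME Deligne's hyperbolic reach `weilFamilyReach_hyperbolic` and Buchweitz–Flenner Thm. 5.1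
(`BuchweitzFlenner2003_variationalHodge_ISemiregular`), both REFEREED: ONE hyperbolic locally free `I`-semiregular sheaf seed on a
split `ℚ(i)`-Weil abelian TENFOLD (`HasHyperbolicBFSheafSeed C 5 1 I`) settles EVERY sixfold cell `(3, 1, δ)`, `δ ∈ ℚˣ/Nm ℚ(i)ˣ`
— split and non-split alike: `WeilClassesComponent 3 1 δ`. (p3's `weilAlgebraicAll_discOne_of_sheafSeed_five`, middle conjunct,
read cell by cell through `weilClassesComponent_of_weilAlgebraicAll`; the degeneration edges `5 → 4 → 3` are the tree's PROVED
`stub_descend` / Schoen product transfer.) [cite: BuchweitzFlenner2003, Thm. 5.1] [cite: Schoen1998HodgeWeilAddendum, §10]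
[cite: Deligne1982HodgeCycles, proof of Thm. 4.8] -/
theorem weilSixfoldCells_discOne_of_sheafSeed_five (hF : weilFamilyReach_hyperbolic) {C : ChernCharacterBetti}
    {I : Finset ℕ} (hBF : BuchweitzFlenner2003_variationalHodge_ISemiregular) (hS : HasHyperbolicBFSheafSeed C 5 1 I)
    (δ : weilNormResidueGroup 1) : WeilClassesComponent 3 1 δ :=
  weilClassesComponent_of_weilAlgebraicAll (weilAlgebraicAll_discOne_of_sheafSeed_five hF hBF hS).2.1 δ

/-- **DOOR #2, local-anchor form, CELL FORM**: reach ∧ ONE locally algebraic hyperbolic `ℚ(i)`-anchor in dimension `10`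
(`HasLocallyAlgebraicWeilAnchor 5 1` — e.g. from a fully semiregular locally free `κ`-object with rational `B`-field through the
tree's `hasLocallyAlgebraicWeilAnchor_of_perryTwisted_kappaAnchorObject 5 1`, Perry 2026 CLAIM-FACT, UNREFEREED) ⟹ every sixfold
cell `(3, 1, δ)`. [cite: Deligne1982HodgeCycles, proof of Thm. 4.8] [cite: Schoen1998HodgeWeilAddendum, §10] -/
theorem weilSixfoldCells_discOne_of_localAnchor_five (hF : weilFamilyReach_hyperbolic)
    (hL : HasLocallyAlgebraicWeilAnchor 5 1) (δ : weilNormResidueGroup 1) : WeilClassesComponent 3 1 δ :=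
  weilClassesComponent_of_weilAlgebraicAll (weilAlgebraicAll_discOne_of_localAnchor_five hF hL).2.1 δ

/-! ## §6 (appended) The ONE-MODEL sheaf door (`SheafSeedOnAnchor.lean`, th-2 p323405): cell forms with 0 transport obligations

`HasBFSheafSeedAt C n I P h w` (§1 door D2) asks for the `I`-semiregular bundle on EVERY model `e : P.X ≅ X₀`; a census row certifies ONE
object on ONE model. `SheafSeedOnAnchor.lean` restates the door with the seed ON `P.X` (`HasBFSheafSeedOn C n I P h w`) against the
model rendering `BuchweitzFlenner2003_variationalHodge_ISemiregular_model` of BF Thm. 5.1 (the model isomorphism in its binders; the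
fixed-fibre fact is its proved corollary; referee REVIEW-LEAN-SPINE-1 §3(c) re-assessed 08:28Z: faithful to print, the Summit-side
transport obligation becomes this mechanical follow-up). The three declarations below are the §1 / §3 / §5 sheaf doors with the
predicate swapped — so a locally free `I`-semiregular row of the TARGET-TABLE instantiates them LITERALLY (one object, one model).
CAVEAT C1 (finite locally free `ℰ₀` only) is unchanged. -/

/-- **Door D2, ONE-MODEL form (finite locally free `I`-semiregular vector bundle ON the anchor), cell form, any `(n, d, δ)`.**
Granting BY NAME Deligne's reach-by-similitude `weilFamilyReach_similar` and Buchweitz–Flenner Thm. 5.1 in its model rendering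
`BuchweitzFlenner2003_variationalHodge_ISemiregular_model` (both REFEREED named facts): a polarized member `(P, ψ₀, h_K)` of Weil
type `(n, d)` of the cell `δ`, a non-zero rational Weil class `w` on it, and ONE `I`-semiregular finite locally free `ℰ₀` on `P.X`
itself with `ch_n(ℰ₀) = q·h_Kⁿ + w`, `ch_p(ℰ₀) = c_p·h_Kᵖ` (`p ∈ I ∖ {n}`, `n ∈ I`) — `HasBFSheafSeedOn C n I P h_K w` — ⟹
`WeilClassesComponent n d δ`. (`weilClassesComponent_of_localClause_member` fed with
`weilAnchorLocalClause_of_BFmodel_of_sheafSeedOn`; nothing asserted.) [cite: BuchweitzFlenner2003, §5 Thm. 5.1]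
[cite: Deligne1982HodgeCycles, proof of Thm. 4.8] [cite: vanGeemen1994HodgeAV, Lemma 5.2 (3)–(4) and Thm. 5.3] -/
theorem weilClassesComponent_of_sheafSeedOn_member {n d : ℕ} {δ : weilNormResidueGroup d}
    (hF : weilFamilyReach_similar) (C : ChernCharacterBetti) {I : Finset ℕ}
    (hBF : BuchweitzFlenner2003_variationalHodge_ISemiregular_model)
    {P : AbelianVariety ℂ} {ψ₀ : P ⟶ P} (hW : IsWeilType P ψ₀ n d) (e : ProjectiveEmbedding P.X)
    {a : complexBetti (projectiveSpace e.n ℂ) 2} (haQ : IsRationalClass a) (ha0 : a ≠ 0)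
    (hδ : HasWeilDiscriminantNondeg P ψ₀ n d (symmetrisedClass d P ψ₀ e a) δ)
    {w : complexBetti P.X (2 * n)} (hwW : w ∈ weilClassesOf P ψ₀ n d) (hwQ : IsRationalClass w) (hw0 : w ≠ 0)
    (hS : HasBFSheafSeedOn C n I P (symmetrisedClass d P ψ₀ e a) w) :
    WeilClassesComponent n d δ :=
  weilClassesComponent_of_localClause_member hF hW e haQ ha0 hδ hwW hwQ hw0
    (weilAnchorLocalClause_of_BFmodel_of_sheafSeedOn d C hBF hS)

/-- **`g = 6`, door D2 in ONE-MODEL form, cell `(3, d, δ)`** — transport `BuchweitzFlenner2003_variationalHodge_ISemiregular_model`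
(BF Thm. 5.1, model rendering, REFEREED), object `HasBFSheafSeedOn C 3 I P h_K w`: ONE `I`-semiregular finite locally free `ℰ₀` on
the sixfold `P.X` with `ch₃(ℰ₀) = q·h_K³ + w`, `ch_p(ℰ₀) = c_p·h_Kᵖ` for `p ∈ I ∖ {3}`. The TARGET-TABLE template for a locally
free sheaf row. [cite: BuchweitzFlenner2003, §5 Thm. 5.1] [cite: Deligne1982HodgeCycles, proof of Thm. 4.8] -/
theorem weilSixfoldComponent_of_sheafSeedOn_member {d : ℕ} {δ : weilNormResidueGroup d}
    (hF : weilFamilyReach_similar) (C : ChernCharacterBetti) {I : Finset ℕ}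
    (hBF : BuchweitzFlenner2003_variationalHodge_ISemiregular_model)
    {P : AbelianVariety ℂ} {ψ₀ : P ⟶ P} (hW : IsWeilType P ψ₀ 3 d) (e : ProjectiveEmbedding P.X)
    {a : complexBetti (projectiveSpace e.n ℂ) 2} (haQ : IsRationalClass a) (ha0 : a ≠ 0)
    (hδ : HasWeilDiscriminantNondeg P ψ₀ 3 d (symmetrisedClass d P ψ₀ e a) δ)
    {w : complexBetti P.X 6} (hwW : w ∈ weilClassesOf P ψ₀ 3 d) (hwQ : IsRationalClass w) (hw0 : w ≠ 0)
    (hS : HasBFSheafSeedOn C 3 I P (symmetrisedClass d P ψ₀ e a) w) :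
    WeilClassesComponent 3 d δ :=
  weilClassesComponent_of_sheafSeedOn_member hF C hBF hW e haQ ha0 hδ hwW hwQ hw0 hS

/-- **DOOR #2 of the cell (`K = ℚ(i)`, level `5`, split tenfold), ONE-MODEL sheaf form, CELL FORM.** Granting BY NAME Deligne's
hyperbolic reach `weilFamilyReach_hyperbolic` and BF Thm. 5.1 in its model rendering
(`BuchweitzFlenner2003_variationalHodge_ISemiregular_model`), both REFEREED: ONE hyperbolic locally free `I`-semiregular sheaf
seed ON a split `ℚ(i)`-Weil abelian TENFOLD (`HasHyperbolicBFSheafSeedOn C 5 1 I` — one object on one model) settles EVERY sixfold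
cell `(3, 1, δ)`, split and non-split alike: `WeilClassesComponent 3 1 δ` (th-2's `weilAlgebraicAll_discOne_of_sheafSeedOn_five`,
middle conjunct, read cell by cell through `weilClassesComponent_of_weilAlgebraicAll`). [cite: BuchweitzFlenner2003, §5 Thm. 5.1]
[cite: Schoen1998HodgeWeilAddendum, §10] [cite: Deligne1982HodgeCycles, proof of Thm. 4.8] -/
theorem weilSixfoldCells_discOne_of_sheafSeedOn_five (hF : weilFamilyReach_hyperbolic) {C : ChernCharacterBetti}
    {I : Finset ℕ} (hBF : BuchweitzFlenner2003_variationalHodge_ISemiregular_model) (hS : HasHyperbolicBFSheafSeedOn C 5 1 I)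
    (δ : weilNormResidueGroup 1) : WeilClassesComponent 3 1 δ :=
  weilClassesComponent_of_weilAlgebraicAll (weilAlgebraicAll_discOne_of_sheafSeedOn_five hF hBF hS).2.1 δ

end Summit.Ventures.HSemireg

end
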